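import Literature.Claims.NS.Ramm2024
import Mathlib.Analysis.SpecialFunctions.ImproperIntegrals
import Mathlib.Analysis.SpecialFunctions.Pow.Asymptotics
import Mathlib.MeasureTheory.Integral.ExpDecay
import HarnessLib

/-!
# NS-claims map (cell `ns-claims`, D-0090), claim C04 `Ramm2024`, part A: the NS-free Laplace core

A. G. Ramm, *Navier–Stokes equations paradox* line (Modern Math. Methods 2 (2024) 19–26; typed skeleton
`Literature.Claims.NS.Ramm2024`, print locators there). One of three files holding ns-claims-refuter-2's
kernel refutation of the skeleton's Step 3 (`Step3_hyperSingularIneq`, inequality (1.19) p. 22 ≡ (1.29)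
p. 23); split for the gate's 400-line cap; filed for the author by the cell's salvage prover under the
cell's interim convention (b), content unchanged. THIS PART (real analysis only, written by
ns-claims-typist-4 as hand-over support material `RammKit.lean` v3 and adopted verbatim up to naming):
if `b ≥ 0` on `(0,∞)`, `b ≥ β > 0` on some `(0,δ)`, `b₀ ≤ B` on `(0,∞)`, and `w` has Laplace transform
`Lw = p^{1/4}·Lb` with the integrability clauses of `IsPhiConv (−1/4) b w`, then `b ≤ b₀ − k·w` on
`(0,∞)` with `k > 0` is contradictory (`false_of_hyperSingular`): Laplace-transforming gives
`p^{1/4} Lb(p) = Lw(p) ≤ B/(kp)` against `Lb(p) ≥ β(1 − e^{−pδ})/p`, i.e. `β(1 − e^{−pδ}) ≤ (B/k)p^{−1/4}`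
for all `p > 0`, and `p → ∞` forces `β ≤ 0`. Packaged against the skeleton as `not_step3_of_witness`:
ONE solution in the `Setting` with such bounds refutes Step 3. Parts B (`SoloRefuteRamm2024Grad.lean`:
the two witness-side bounds) and C (`SoloRefuteRamm2024.lean`: the witness and the verdict theorems).
Axioms: `propext`, `Classical.choice`, `Quot.sound` only.
WHAT THIS IS NOT: not a claim about NS regularity or blow-up; not a claim about any author beyond the
typed locator.
-/

-- The summit's canonical theorem namespace repeats the summit name (single-conjunct summit).
set_option linter.dupNamespace false

noncomputable section

open MeasureTheory Set Filter Real
open scoped Topology ENNReal ContDiff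

namespace Summit.NavierStokesRegularity.NavierStokesRegularity.Theorems.Ramm2024

open Literature.Analysis.Asymptotics Literature.Claims.NS.Ramm2024

/-! ### Laplace-transform inequalities on `(0,∞)` -/

/-- For `p > 0`, `t ↦ C * exp (-(p t))` is integrable on `(0,∞)`. -/
theorem integrableOn_const_mul_exp_neg {p : ℝ} (hp : 0 < p) (C : ℝ) :
    IntegrableOn (fun t : ℝ => C * Real.exp (-(p * t))) (Ioi 0) := by
  have h' : IntegrableOn (fun t : ℝ => Real.exp (-(p * t))) (Ioi 0) := by
    refine (exp_neg_integrableOn_Ioi 0 hp).congr_fun (fun t _ => ?_) measurableSet_Ioi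
    simp [neg_mul]
  exact h'.const_mul C

/-- `∫_{(0,∞)} C e^{-pt} dt = C / p` for `p > 0`. -/
theorem integral_const_mul_exp_neg {p : ℝ} (hp : 0 < p) (C : ℝ) :
    ∫ t in Ioi (0 : ℝ), C * Real.exp (-(p * t)) = C / p := by
  have h := integral_exp_mul_Ioi (a := -p) (by linarith) 0
  have h2 : ∫ t in Ioi (0 : ℝ), Real.exp (-(p * t)) = 1 / p := by
    have : (fun t : ℝ => Real.exp (-(p * t))) = fun t => Real.exp (-p * t) := by
      funext t; simp [neg_mul]
    rw [this, h]
    have hp' : p ≠ 0 := hp.ne'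
    field_simp
    simp
  rw [integral_const_mul, h2]
  field_simp

/-- Upper bound: if `w ≤ M` on `(0,∞)` and `w e^{-p·}` is integrable there, `(Lw)(p) ≤ M / p`. -/
theorem laplace_le_of_le {w : ℝ → ℝ} {M p : ℝ} (hp : 0 < p)
    (hw : IntegrableOn (fun t => w t * Real.exp (-(p * t))) (Ioi 0))
    (hle : ∀ t : ℝ, 0 < t → w t ≤ M) :
    KaramataLaplace.laplace w p ≤ M / p := by
  unfold KaramataLaplace.laplace
  rw [← integral_const_mul_exp_neg hp M]
  refine setIntegral_mono_on hw (integrableOn_const_mul_exp_neg hp M) measurableSet_Ioi ?_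
  intro t ht
  exact mul_le_mul_of_nonneg_right (hle t ht) (Real.exp_pos _).le

/-- `∫_{(0,δ)} e^{-pt} dt = (1 - e^{-pδ}) / p`. -/
theorem integral_exp_neg_Ioo {p δ : ℝ} (hp : 0 < p) (hδ : 0 < δ) :
    ∫ t in Ioo (0 : ℝ) δ, Real.exp (-(p * t)) = (1 - Real.exp (-(p * δ))) / p := by
  rw [← integral_Ioc_eq_integral_Ioo, ← intervalIntegral.integral_of_le hδ.le]
  have hderiv : ∀ t ∈ uIcc (0 : ℝ) δ,
      HasDerivAt (fun s : ℝ => -Real.exp (-(p * s)) / p) (Real.exp (-(p * t))) t := by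
    intro t _
    have h1 : HasDerivAt (fun s : ℝ => -(p * s)) (-p) t := by
      simpa [neg_mul] using (hasDerivAt_id t).const_mul (-p)
    have h2 : HasDerivAt (fun s : ℝ => Real.exp (-(p * s))) (Real.exp (-(p * t)) * (-p)) t :=
      h1.exp
    have h3 : HasDerivAt (fun s : ℝ => -Real.exp (-(p * s)) / p)
        (-(Real.exp (-(p * t)) * (-p)) / p) t := (h2.neg).div_const p
    refine h3.congr_deriv ?_
    have hp' : p ≠ 0 := hp.ne'
    field_simp
  rw [intervalIntegral.integral_eq_sub_of_hasDerivAt hderiv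
    ((continuous_const.mul continuous_id).neg.rexp.intervalIntegrable _ _)]
  simp
  field_simp
  ring

/-- Lower bound: if `b ≥ 0` on `(0,∞)`, `b ≥ β` on `(0,δ)` and `b e^{-p·}` is integrable on
`(0,∞)`, then `(Lb)(p) ≥ β (1 − e^{−pδ}) / p`. -/
theorem le_laplace_of_ge {b : ℝ → ℝ} {β δ p : ℝ} (hp : 0 < p) (hδ : 0 < δ)
    (hb : IntegrableOn (fun t => b t * Real.exp (-(p * t))) (Ioi 0))
    (hb0 : ∀ t : ℝ, 0 < t → 0 ≤ b t) (hβ : ∀ t ∈ Ioo (0 : ℝ) δ, β ≤ b t) :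
    β * ((1 - Real.exp (-(p * δ))) / p) ≤ KaramataLaplace.laplace b p := by
  unfold KaramataLaplace.laplace
  have hsub : Ioo (0 : ℝ) δ ⊆ Ioi 0 := fun t ht => ht.1
  have hbI : IntegrableOn (fun t => b t * Real.exp (-(p * t))) (Ioo 0 δ) := hb.mono_set hsub
  have hcI : IntegrableOn (fun t : ℝ => β * Real.exp (-(p * t))) (Ioo 0 δ) :=
    (integrableOn_const_mul_exp_neg hp β).mono_set hsub
  calc β * ((1 - Real.exp (-(p * δ))) / p)
      = ∫ t in Ioo (0 : ℝ) δ, β * Real.exp (-(p * t)) := by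
        rw [integral_const_mul, integral_exp_neg_Ioo hp hδ]
    _ ≤ ∫ t in Ioo (0 : ℝ) δ, b t * Real.exp (-(p * t)) := by
        refine setIntegral_mono_on hcI hbI measurableSet_Ioo ?_
        intro t ht
        exact mul_le_mul_of_nonneg_right (hβ t ht) (Real.exp_pos _).le
    _ ≤ ∫ t in Ioi (0 : ℝ), b t * Real.exp (-(p * t)) := by
        refine setIntegral_mono_set hb ?_ (Eventually.of_forall hsub)
        filter_upwards [ae_restrict_mem measurableSet_Ioi] with t ht
        exact mul_nonneg (hb0 t ht) (Real.exp_pos _).le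

/-- **The NS-free core of the refutation of Step 3.** With `k > 0`, `b ≥ 0` on `(0,∞)`, `b ≥ β > 0`
on `(0,δ)`, `b₀ ≤ B` on `(0,∞)`, `Lw = p^{1/4} Lb` (with the integrability clauses of
`IsPhiConv (-(1/4)) b w`, exponent written as the skeleton writes it, `p ^ (-(-(1/4)))`), the
inequality `b t ≤ b₀ t − k · w t` for all `t > 0` is contradictory. -/
theorem false_of_hyperSingular {b b0 w : ℝ → ℝ} {k B β δ : ℝ} (hk : 0 < k) (hβ : 0 < β)
    (hδ : 0 < δ) (hb0 : ∀ t : ℝ, 0 < t → 0 ≤ b t) (hB : ∀ t : ℝ, 0 < t → b0 t ≤ B)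
    (hlow : ∀ t ∈ Ioo (0 : ℝ) δ, β ≤ b t)
    (hint : ∀ p : ℝ, 0 < p →
      IntegrableOn (fun t => b t * Real.exp (-(p * t))) (Ioi 0) ∧
      IntegrableOn (fun t => w t * Real.exp (-(p * t))) (Ioi 0) ∧
      KaramataLaplace.laplace w p = p ^ (-(-(1 / 4 : ℝ))) * KaramataLaplace.laplace b p)
    (hineq : ∀ t : ℝ, 0 < t → b t ≤ b0 t - k * w t) : False := by
  -- pointwise: w ≤ B / k on (0,∞)
  have hwle : ∀ t : ℝ, 0 < t → w t ≤ B / k := by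
    intro t ht
    rw [le_div_iff₀ hk]
    have := hineq t ht
    have := hB t ht
    have := hb0 t ht
    nlinarith
  -- key inequality for every p > 0
  have key : ∀ p : ℝ, 0 < p → β * (1 - Real.exp (-(p * δ))) ≤ B / k * p ^ (-(1 / 4 : ℝ)) := by
    intro p hp
    obtain ⟨hbI, hwI, hL⟩ := hint p hp
    have h14 : -(-(1 / 4 : ℝ)) = 1 / 4 := by norm_num
    rw [h14] at hL
    have hup : KaramataLaplace.laplace w p ≤ B / k / p := laplace_le_of_le hp hwI hwle
    have hlo : β * ((1 - Real.exp (-(p * δ))) / p) ≤ KaramataLaplace.laplace b p :=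
      le_laplace_of_ge hp hδ hbI hb0 hlow
    have hp14 : 0 < p ^ (1 / 4 : ℝ) := Real.rpow_pos_of_pos hp _
    -- p^{1/4} * (β (1 - e^{-pδ}) / p) ≤ B/k/p
    have h1 : p ^ (1 / 4 : ℝ) * (β * ((1 - Real.exp (-(p * δ))) / p)) ≤ B / k / p := by
      calc p ^ (1 / 4 : ℝ) * (β * ((1 - Real.exp (-(p * δ))) / p))
          ≤ p ^ (1 / 4 : ℝ) * KaramataLaplace.laplace b p :=
            mul_le_mul_of_nonneg_left hlo hp14.le
        _ = KaramataLaplace.laplace w p := hL.symm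
        _ ≤ B / k / p := hup
    have h2 : p ^ (1 / 4 : ℝ) * (β * (1 - Real.exp (-(p * δ)))) ≤ B / k := by
      have := mul_le_mul_of_nonneg_left h1 hp.le
      have e1 : p * (p ^ (1 / 4 : ℝ) * (β * ((1 - Real.exp (-(p * δ))) / p))) =
          p ^ (1 / 4 : ℝ) * (β * (1 - Real.exp (-(p * δ)))) := by
        field_simp
      have e2 : p * (B / k / p) = B / k := by field_simp
      rw [e1, e2] at this
      exact this
    rw [Real.rpow_neg hp.le, ← div_eq_mul_inv, le_div_iff₀ hp14]
    linarith [h2]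
  -- limits as p → ∞
  have hf : Tendsto (fun p : ℝ => β * (1 - Real.exp (-(p * δ)))) atTop (𝓝 β) := by
    have h1 : Tendsto (fun p : ℝ => Real.exp (-(p * δ))) atTop (𝓝 0) :=
      tendsto_exp_neg_atTop_nhds_zero.comp (tendsto_id.atTop_mul_const hδ)
    have h2 := (tendsto_const_nhds (x := (1 : ℝ))).sub h1
    simpa using h2.const_mul β
  have hg : Tendsto (fun p : ℝ => B / k * p ^ (-(1 / 4 : ℝ))) atTop (𝓝 0) := by
    simpa using (tendsto_rpow_neg_atTop (by norm_num : (0 : ℝ) < 1 / 4)).const_mul (B / k)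
  have hle : β ≤ 0 :=
    le_of_tendsto_of_tendsto hf hg (by
      filter_upwards [eventually_gt_atTop (0 : ℝ)] with p hp using key p hp)
  exact absurd hle (not_le.mpr hβ)

/-! ### Packaging against the skeleton: one witness with two bounds refutes Step 3 -/

/-- `c·c₁ > 0` for `c > 0`, where `c₁ = |Γ(−1/4)|` (`Γ` has no pole at `−1/4`). -/
theorem mul_c₁_pos {c : ℝ} (hc : 0 < c) : 0 < c * c₁ := by
  refine mul_pos hc ?_
  unfold c₁
  refine abs_pos.mpr (Real.Gamma_ne_zero ?_)
  intro m h
  have h4 : (4 : ℝ) * (-(1 / 4 : ℝ)) = 4 * (-(m : ℝ)) := by rw [h]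
  have : (4 : ℝ) * (m : ℝ) = 1 := by linarith
  have hm : (4 * m : ℤ) = 1 := by exact_mod_cast this
  omega

/-- `b ≥ 0` by definition. -/
theorem b_nonneg (v : ℝ → EuclideanSpace ℝ (Fin 3) → EuclideanSpace ℝ (Fin 3)) (t : ℝ) : 0 ≤ b v t := by
  unfold b
  exact mul_nonneg (Real.rpow_nonneg (by positivity) _) ENNReal.toReal_nonneg

/-- **¬ Step 3 of C04 from one witness.** A solution `(ν, u₀, u, p)` in the `Setting` whose `b` stays
above some `β > 0` on an initial interval `(0,δ)` (e.g. any solution with `∇u₀ ≢ 0`, by lower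
semicontinuity of `‖∇u(t)‖₂` at `t = 0⁺`) and whose free heat flow has `b₀ ≤ B` on `(0,∞)` (e.g. by
`‖∇e^{νtΔ}u₀‖₂ ≤ ‖∇u₀‖₂`) refutes `Step3_hyperSingularIneq`. -/
theorem not_step3_of_witness {ν : ℝ} {u₀ : EuclideanSpace ℝ (Fin 3) → EuclideanSpace ℝ (Fin 3)}
    {u : ℝ → EuclideanSpace ℝ (Fin 3) → EuclideanSpace ℝ (Fin 3)}
    {p : ℝ → EuclideanSpace ℝ (Fin 3) → ℝ} (hS : Setting ν u₀ u p)
    (hlow : ∃ β δ : ℝ, 0 < β ∧ 0 < δ ∧ ∀ t ∈ Ioo (0 : ℝ) δ, β ≤ b u t)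
    (hB : ∃ B : ℝ, ∀ t : ℝ, 0 < t → b₀ ν u₀ t ≤ B) :
    ¬ Step3_hyperSingularIneq := by
  intro h3
  obtain ⟨c, hc, hall⟩ := h3 ν u₀ hS.viscosity_pos hS.data_smooth hS.data_decay hS.data_divFree
  obtain ⟨w, hphi, hineq⟩ := hall u p hS
  obtain ⟨β, δ, hβ, hδ, hlow⟩ := hlow
  obtain ⟨B, hB⟩ := hB
  refine false_of_hyperSingular (b := b u) (b0 := b₀ ν u₀) (w := w) (k := c * c₁) (B := B)
    (mul_c₁_pos hc) hβ hδ (fun t _ => b_nonneg u t) hB hlow ?_ ?_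
  · intro q hq
    exact hphi.2 q hq
  · intro t ht
    have := (hineq t ht).2
    linarith

end Summit.NavierStokesRegularity.NavierStokesRegularity.Theorems.Ramm2024

end

-- WHAT THIS IS NOT: not a claim about NS regularity or blow-up; not a claim about any author beyond the
-- typed locator.
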